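import Mathlib
import Literature.Analysis.PDE.Wave1DDuhamelBound
import Literature.Analysis.PDE.Wave1DFarEnergyLimits
import HarnessLib

/-!
# Far-side Duhamel comparison of exterior energies for two potentials close at infinity

Analysis/PDE support file (everything proved). Let `φ` be a global `C²` solution of
`φ_tt − φ_xx + P φ = F_φ` with `F_φ = 0` on `{x ≥ 1}` and finite `P`-energy `E₀` of its data on
`(1, ∞)`, and let `φ₀` be a global `C²` solution of `φ₀_tt − φ₀_xx + V₀ φ₀ = F₀` with `F₀ = 0`
on `{x ≥ 1}` and the SAME data at `t = 0` (`P, V₀ ≥ 0` continuous). If on `{x ≥ 1}`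

  `(V₀ − P)² ≤ δ² x^{−2σ} P`  (`σ > 1`)  and  `V₀ ≤ (1 + ε') P`,

then for every `t ≥ 0` the `V₀`-energy of `φ₀(t)` on `{x > 1 + t}` is finite and

  `∫_{x>1+t} e_{V₀}[φ₀](t) ≤ 2(1+ε') ∫_{x>1+t} e_P[φ](t) + 8 δ² E₀ / (σ−1)²`

(`wave1D_far_duhamel_comparison`). Mechanism: `w = φ − φ₀` has zero data and source
`(V₀ − P)φ` on the far trapezoids `{1 + τ ≤ x ≤ Y − τ}`; the Duhamel bound
(`Wave1DDuhamelBound.lean`) with `‖(V₀−P)φ(τ)‖_{L²(x>1+τ)} ≤ δ(1+τ)^{−σ} √E₀` (exterior `P`-energy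
is non-increasing, `Wave1DFarEnergyLimits.lean`) gives `E^{V₀}[w](t) ≤ 4δ²E₀/(σ−1)²` on every
truncated trapezoid; then `e[φ₀] ≤ 2e[φ] + 2e[w]`, `e_{V₀}[φ] ≤ (1+ε')e_P[φ]`, and `Y → ∞`. This is
the perturbative step transferring the exact inverse-square channel estimate to the true
Regge–Wheeler-type potential on the far side (route PhotonSphereChannels, `FixedModeChannels`,
stmt-FinalStateConjecture-10048). Folklore (Duyckaerts–Kenig–Merle-type perturbation arguments).
-/

noncomputable section

namespace Literature.Analysis.PDE

open MeasureTheory Set Filter Topology intervalIntegral Real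

variable {V₀ P : ℝ → ℝ} {φ φ₀ Fφ F₀ : ℝ → ℝ → ℝ}

/-- Slices of a `C²` function of two variables are `C²`. [folklore] -/
theorem contDiff_two_slices' {ψ : ℝ → ℝ → ℝ} (hψ : ContDiff ℝ 2 (Function.uncurry ψ)) (t x : ℝ) :
    ContDiff ℝ 2 (fun τ => ψ τ x) ∧ ContDiff ℝ 2 (ψ t) :=
  ⟨hψ.comp (contDiff_id.prodMk contDiff_const), hψ.comp (contDiff_const.prodMk contDiff_id)⟩

section
variable (hV₀ : Continuous V₀) (hV₀0 : ∀ x, 0 ≤ V₀ x) (hP : Continuous P) (hP0 : ∀ x, 0 ≤ P x)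
  (hφ : ContDiff ℝ 2 (Function.uncurry φ)) (hFφ : Continuous (Function.uncurry Fφ))
  (hφsol : ∀ t x, iteratedDeriv 2 (fun τ => φ τ x) t - iteratedDeriv 2 (φ t) x + P x * φ t x
    = Fφ t x)
  (hFφ0 : ∀ τ x, 1 ≤ x → Fφ τ x = 0)
  (hφ₀ : ContDiff ℝ 2 (Function.uncurry φ₀)) (hF₀ : Continuous (Function.uncurry F₀))
  (hφ₀sol : ∀ t x, iteratedDeriv 2 (fun τ => φ₀ τ x) t - iteratedDeriv 2 (φ₀ t) x + V₀ x * φ₀ t x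
    = F₀ t x)
  (hF₀0 : ∀ τ x, 1 ≤ x → F₀ τ x = 0)
  (hdata : ∀ x, φ₀ 0 x = φ 0 x ∧ deriv (fun τ => φ₀ τ x) 0 = deriv (fun τ => φ τ x) 0)
  {δ σ ε' : ℝ} (hδ : 0 ≤ δ) (hσ : 1 < σ) (hε' : 0 ≤ ε')
  (hq : ∀ x, 1 ≤ x → (V₀ x - P x) ^ 2 ≤ δ ^ 2 * x ^ (-(2 * σ)) * P x)
  (hVP : ∀ x, 1 ≤ x → V₀ x ≤ (1 + ε') * P x)
  (hfin : ∫⁻ x in Ioi 1, ENNReal.ofReal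
    (deriv (fun τ => φ τ x) 0 ^ 2 + deriv (φ 0) x ^ 2 + P x * φ 0 x ^ 2) < ⊤)
include hV₀ hV₀0 hP hP0 hφ hFφ hφsol hFφ0 hφ₀ hF₀ hφ₀sol hF₀0 hdata hδ hσ hε' hq hVP hfin

omit hV₀0 hφ₀ hF₀ hφ₀sol hF₀0 hdata hδ hε' hVP in
/-- **The source bound on far intervals**: for `0 ≤ τ` and any `Y`,
`∫_{1+τ}^{Y−τ} ((V₀−P)φ(τ))² ≤ δ²(1+τ)^{−2σ} E₀`. [folklore] -/
theorem far_source_sq_integral_le {τ : ℝ} (hτ : 0 ≤ τ) (Y : ℝ) (hY : 1 + τ ≤ Y - τ) :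
    (∫ x in (1 + τ)..(Y - τ), ((V₀ x - P x) * φ τ x) ^ 2)
      ≤ δ ^ 2 * (1 + τ) ^ (-(2 * σ)) * ∫ x in Ioi 1,
          (deriv (fun s => φ s x) 0 ^ 2 + deriv (φ 0) x ^ 2 + P x * φ 0 x ^ 2) := by
  have hF0' : ∀ s x, 1 ≤ x → Fφ s x = 0 := hFφ0
  have hint := (wave1D_farEnergy_integrableOn hP hP0 hFφ hφ hφsol (c := 1) hF0' hfin τ).1
  have hmono := wave1D_farEnergy_real_mono_nonneg hP hP0 hFφ hφ hφsol (c := 1) hF0' hfin le_rfl hτ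
  rw [abs_of_nonneg hτ] at hint hmono
  simp only [abs_zero, add_zero] at hmono
  have hτ0 : 0 < 1 + τ := by linarith
  -- pointwise bound on `[1+τ, Y−τ]`
  have hpt : ∀ x ∈ Icc (1 + τ) (Y - τ), ((V₀ x - P x) * φ τ x) ^ 2
      ≤ δ ^ 2 * (1 + τ) ^ (-(2 * σ)) * (deriv (fun s => φ s x) τ ^ 2 + deriv (φ τ) x ^ 2
        + P x * φ τ x ^ 2) := by
    intro x hx
    have hx1 : 1 ≤ x := by linarith [hx.1]
    have hx0 : 0 < x := by linarith
    have h1 : x ^ (-(2 * σ)) ≤ (1 + τ) ^ (-(2 * σ)) :=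
      rpow_le_rpow_of_nonpos hτ0 hx.1 (by linarith)
    have h2 : ((V₀ x - P x) * φ τ x) ^ 2 ≤ δ ^ 2 * (1 + τ) ^ (-(2 * σ)) * (P x * φ τ x ^ 2) := by
      calc ((V₀ x - P x) * φ τ x) ^ 2 = (V₀ x - P x) ^ 2 * φ τ x ^ 2 := by ring
        _ ≤ (δ ^ 2 * x ^ (-(2 * σ)) * P x) * φ τ x ^ 2 :=
            mul_le_mul_of_nonneg_right (hq x hx1) (sq_nonneg _)
        _ ≤ (δ ^ 2 * (1 + τ) ^ (-(2 * σ)) * P x) * φ τ x ^ 2 := by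
            have := hP0 x; gcongr
        _ = δ ^ 2 * (1 + τ) ^ (-(2 * σ)) * (P x * φ τ x ^ 2) := by ring
    refine h2.trans (mul_le_mul_of_nonneg_left ?_ (by positivity))
    nlinarith [sq_nonneg (deriv (fun s => φ s x) τ), sq_nonneg (deriv (φ τ) x)]
  have hcV : Continuous fun x => ((V₀ x - P x) * φ τ x) ^ 2 :=
    (((hV₀.sub hP)).mul (hφ.continuous.comp (continuous_const.prodMk continuous_id))).pow 2
  have hce : Continuous fun x => deriv (fun s => φ s x) τ ^ 2 + deriv (φ τ) x ^ 2
      + P x * φ τ x ^ 2 :=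
    (continuous_wave1D_energyDensity hP hφ).comp (continuous_const.prodMk continuous_id)
  calc (∫ x in (1 + τ)..(Y - τ), ((V₀ x - P x) * φ τ x) ^ 2)
      ≤ ∫ x in (1 + τ)..(Y - τ), δ ^ 2 * (1 + τ) ^ (-(2 * σ))
          * (deriv (fun s => φ s x) τ ^ 2 + deriv (φ τ) x ^ 2 + P x * φ τ x ^ 2) :=
        intervalIntegral.integral_mono_on hY (hcV.intervalIntegrable _ _)
          ((hce.intervalIntegrable _ _).const_mul _) hpt
    _ = δ ^ 2 * (1 + τ) ^ (-(2 * σ)) * ∫ x in (1 + τ)..(Y - τ),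
          (deriv (fun s => φ s x) τ ^ 2 + deriv (φ τ) x ^ 2 + P x * φ τ x ^ 2) :=
        intervalIntegral.integral_const_mul _ _
    _ ≤ δ ^ 2 * (1 + τ) ^ (-(2 * σ)) * ∫ x in Ioi (1 + τ),
          (deriv (fun s => φ s x) τ ^ 2 + deriv (φ τ) x ^ 2 + P x * φ τ x ^ 2) := by
        refine mul_le_mul_of_nonneg_left ?_ (by positivity)
        rw [intervalIntegral.integral_of_le hY]
        exact setIntegral_mono_set hint (ae_of_all _ fun x => wave1D_energyDensity_nonneg hP0 τ x)
          (ae_of_all _ Ioc_subset_Ioi_self)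
    _ ≤ δ ^ 2 * (1 + τ) ^ (-(2 * σ)) * ∫ x in Ioi 1,
          (deriv (fun s => φ s x) 0 ^ 2 + deriv (φ 0) x ^ 2 + P x * φ 0 x ^ 2) :=
        mul_le_mul_of_nonneg_left hmono (by positivity)

omit hV₀0 hφ₀ hF₀ hφ₀sol hF₀0 hdata hε' hVP in
/-- **The time integral of the source norm**: for `0 ≤ t`, `1 + t ≤ Y − t`,
`∫_0^t √(∫_{1+τ}^{Y−τ} ((V₀−P)φ(τ))²) dτ ≤ δ √E₀ / (σ − 1)`. [folklore] -/
theorem far_source_sqrt_integral_le {t : ℝ} (ht : 0 ≤ t) (Y : ℝ) (hY : 1 + t ≤ Y - t) :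
    (∫ τ in (0:ℝ)..t, Real.sqrt (∫ x in (1 + τ)..(Y - τ), ((V₀ x - P x) * φ τ x) ^ 2))
      ≤ δ * Real.sqrt (∫ x in Ioi 1,
          (deriv (fun s => φ s x) 0 ^ 2 + deriv (φ 0) x ^ 2 + P x * φ 0 x ^ 2)) / (σ - 1) := by
  set E₀ : ℝ := ∫ x in Ioi 1, (deriv (fun s => φ s x) 0 ^ 2 + deriv (φ 0) x ^ 2 + P x * φ 0 x ^ 2)
    with hE₀
  have hE₀0 : 0 ≤ E₀ := setIntegral_nonneg measurableSet_Ioi fun x _ =>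
    wave1D_energyDensity_nonneg hP0 0 x
  -- continuity of the source norm in `τ`
  have hg : Continuous (Function.uncurry fun τ x => ((V₀ x - P x) * φ τ x) ^ 2) :=
    ((((hV₀.sub hP).comp continuous_snd)).mul hφ.continuous).pow 2
  have hk : Continuous fun τ => ∫ x in (1 + τ)..(Y - τ), ((V₀ x - P x) * φ τ x) ^ 2 := by
    have h1 : Continuous fun τ => ∫ x in (0:ℝ)..(Y - τ), ((V₀ x - P x) * φ τ x) ^ 2 :=
      intervalIntegral.continuous_parametric_intervalIntegral_of_continuous (μ := volume) hg
        (continuous_const.sub continuous_id)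
    have h2 : Continuous fun τ => ∫ x in (0:ℝ)..(1 + τ), ((V₀ x - P x) * φ τ x) ^ 2 :=
      intervalIntegral.continuous_parametric_intervalIntegral_of_continuous (μ := volume) hg
        (continuous_const.add continuous_id)
    have he : (fun τ => ∫ x in (1 + τ)..(Y - τ), ((V₀ x - P x) * φ τ x) ^ 2)
        = fun τ => (∫ x in (0:ℝ)..(Y - τ), ((V₀ x - P x) * φ τ x) ^ 2)
          - ∫ x in (0:ℝ)..(1 + τ), ((V₀ x - P x) * φ τ x) ^ 2 := by
      funext τ
      have hc : Continuous fun x => ((V₀ x - P x) * φ τ x) ^ 2 := hg.uncurry_left τ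
      rw [intervalIntegral.integral_interval_sub_left (hc.intervalIntegrable _ _)
        (hc.intervalIntegrable _ _)]
    rw [he]; exact h1.sub h2
  -- pointwise bound of the source norm
  have hkb : ∀ τ ∈ Icc 0 t, Real.sqrt (∫ x in (1 + τ)..(Y - τ), ((V₀ x - P x) * φ τ x) ^ 2)
      ≤ δ * Real.sqrt E₀ * (1 + τ) ^ (-σ) := by
    intro τ hτ
    have hτ0 : 0 < 1 + τ := by linarith [hτ.1]
    have h := far_source_sq_integral_le hV₀ hP hP0 hφ hFφ hφsol hFφ0 hσ hq hfin hτ.1 Y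
      (by linarith [hτ.2])
    have hsq : δ ^ 2 * (1 + τ) ^ (-(2 * σ)) * E₀ = (δ * Real.sqrt E₀ * (1 + τ) ^ (-σ)) ^ 2 := by
      rw [mul_pow, mul_pow, Real.sq_sqrt hE₀0, ← rpow_natCast ((1 + τ) ^ (-σ)) 2,
        ← rpow_mul hτ0.le]
      push_cast; ring_nf
    calc Real.sqrt (∫ x in (1 + τ)..(Y - τ), ((V₀ x - P x) * φ τ x) ^ 2)
        ≤ Real.sqrt (δ ^ 2 * (1 + τ) ^ (-(2 * σ)) * E₀) := Real.sqrt_le_sqrt h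
      _ = δ * Real.sqrt E₀ * (1 + τ) ^ (-σ) := by
          rw [hsq, Real.sqrt_sq (by positivity)]
  -- integrate
  have hpc : Continuous fun τ : ℝ => δ * Real.sqrt E₀ * (max (1 + τ) (1 / 2)) ^ (-σ) :=
    continuous_const.mul (((continuous_const.add continuous_id).max continuous_const).rpow_const
      fun τ => Or.inl (by positivity))
  calc (∫ τ in (0:ℝ)..t, Real.sqrt (∫ x in (1 + τ)..(Y - τ), ((V₀ x - P x) * φ τ x) ^ 2))
      ≤ ∫ τ in (0:ℝ)..t, δ * Real.sqrt E₀ * (max (1 + τ) (1 / 2)) ^ (-σ) := by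
        refine intervalIntegral.integral_mono_on ht
          ((Real.continuous_sqrt.comp hk).intervalIntegrable _ _) (hpc.intervalIntegrable _ _)
          fun τ hτ => ?_
        rw [max_eq_left (by linarith [hτ.1])]
        exact hkb τ hτ
    _ = δ * Real.sqrt E₀ * ∫ τ in (0:ℝ)..t, (1 + τ) ^ (-σ) := by
        rw [← intervalIntegral.integral_const_mul]
        refine intervalIntegral.integral_congr fun τ hτ => ?_
        rw [uIcc_of_le ht] at hτ
        simp only [max_eq_left (by linarith [hτ.1] : (1 / 2 : ℝ) ≤ 1 + τ)]
    _ = δ * Real.sqrt E₀ * (((1 + t) ^ (-σ + 1) - 1 ^ (-σ + 1)) / (-σ + 1)) := by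
        rw [intervalIntegral.integral_comp_add_left (fun u : ℝ => u ^ (-σ)) 1, add_zero,
          integral_rpow (Or.inr ⟨by linarith, by
            rw [uIcc_of_le (by linarith)]; exact fun h => by linarith [h.1]⟩)]
    _ ≤ δ * Real.sqrt E₀ * (1 / (σ - 1)) := by
        refine mul_le_mul_of_nonneg_left ?_ (by positivity)
        have h1 : 0 ≤ (1 + t) ^ (-σ + 1) := rpow_nonneg (by linarith) _
        have e : ((1 + t) ^ (-σ + 1) - 1 ^ (-σ + 1)) / (-σ + 1)
            = (1 - (1 + t) ^ (-σ + 1)) / (σ - 1) := by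
          rw [one_rpow, div_eq_div_iff (by linarith) (by linarith)]; ring
        rw [e]
        exact div_le_div_of_nonneg_right (by linarith) (by linarith)
    _ = δ * Real.sqrt E₀ / (σ - 1) := by ring

/-- **Far-side Duhamel comparison of exterior energies.** See the module docstring. [folklore] -/
theorem wave1D_far_duhamel_comparison {t : ℝ} (ht : 0 ≤ t) :
    IntegrableOn (fun x => deriv (fun τ => φ₀ τ x) t ^ 2 + deriv (φ₀ t) x ^ 2 + V₀ x * φ₀ t x ^ 2)
        (Ioi (1 + t)) ∧
      (∫ x in Ioi (1 + t), (deriv (fun τ => φ₀ τ x) t ^ 2 + deriv (φ₀ t) x ^ 2 + V₀ x * φ₀ t x ^ 2))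
        ≤ 2 * (1 + ε') * (∫ x in Ioi (1 + t),
            (deriv (fun τ => φ τ x) t ^ 2 + deriv (φ t) x ^ 2 + P x * φ t x ^ 2))
          + 8 * δ ^ 2 / (σ - 1) ^ 2 * ∫ x in Ioi 1,
            (deriv (fun τ => φ τ x) 0 ^ 2 + deriv (φ 0) x ^ 2 + P x * φ 0 x ^ 2) := by
  set E₀ : ℝ := ∫ x in Ioi 1, (deriv (fun s => φ s x) 0 ^ 2 + deriv (φ 0) x ^ 2 + P x * φ 0 x ^ 2)
    with hE₀
  have hE₀0 : 0 ≤ E₀ := setIntegral_nonneg measurableSet_Ioi fun x _ =>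
    wave1D_energyDensity_nonneg hP0 0 x
  -- the difference `w = φ − φ₀` and its source
  set w : ℝ → ℝ → ℝ := fun t x => φ t x - φ₀ t x with hw
  have hwC : ContDiff ℝ 2 (Function.uncurry w) := hφ.sub hφ₀
  set Fw : ℝ → ℝ → ℝ := fun t x => Fφ t x + (V₀ x - P x) * φ t x - F₀ t x with hFw
  have hFwc : Continuous (Function.uncurry Fw) :=
    (hFφ.add (((hV₀.sub hP).comp continuous_snd).mul hφ.continuous)).sub hF₀
  have hwsol : ∀ t x, iteratedDeriv 2 (fun τ => w τ x) t - iteratedDeriv 2 (w t) x + V₀ x * w t x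
      = Fw t x := by
    intro t x
    have e1 : iteratedDeriv 2 (fun τ => w τ x) t
        = iteratedDeriv 2 (fun τ => φ τ x) t - iteratedDeriv 2 (fun τ => φ₀ τ x) t :=
      iteratedDeriv_fun_sub ((contDiff_two_slices' hφ t x).1.contDiffAt)
        ((contDiff_two_slices' hφ₀ t x).1.contDiffAt)
    have e2 : iteratedDeriv 2 (w t) x = iteratedDeriv 2 (φ t) x - iteratedDeriv 2 (φ₀ t) x := by
      show iteratedDeriv 2 (fun y => φ t y - φ₀ t y) x = _
      exact iteratedDeriv_fun_sub ((contDiff_two_slices' hφ t x).2.contDiffAt)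
        ((contDiff_two_slices' hφ₀ t x).2.contDiffAt)
    rw [e1, e2]
    have h1 := hφsol t x; have h2 := hφ₀sol t x
    simp only [hw, hFw]; linarith
  have hdφ : ∀ t x, DifferentiableAt ℝ (fun τ => φ τ x) t ∧ DifferentiableAt ℝ (φ t) x :=
    fun t x => ⟨(contDiff_two_slices' hφ t x).1.differentiable (by norm_num) t,
      (contDiff_two_slices' hφ t x).2.differentiable (by norm_num) x⟩
  have hdφ₀ : ∀ t x, DifferentiableAt ℝ (fun τ => φ₀ τ x) t ∧ DifferentiableAt ℝ (φ₀ t) x :=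
    fun t x => ⟨(contDiff_two_slices' hφ₀ t x).1.differentiable (by norm_num) t,
      (contDiff_two_slices' hφ₀ t x).2.differentiable (by norm_num) x⟩
  have hdw : ∀ t x, DifferentiableAt ℝ (fun τ => w τ x) t ∧ DifferentiableAt ℝ (w t) x :=
    fun t x => ⟨(contDiff_two_slices' hwC t x).1.differentiable (by norm_num) t,
      (contDiff_two_slices' hwC t x).2.differentiable (by norm_num) x⟩
  have hzero : ∀ x, w 0 x = 0 ∧ deriv (fun τ => w τ x) 0 = 0 := by
    intro x
    obtain ⟨h1, h2⟩ := hdata x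
    refine ⟨by simp [hw, h1], ?_⟩
    show deriv (fun τ => φ τ x - φ₀ τ x) 0 = 0
    rw [deriv_fun_sub (hdφ 0 x).1 (hdφ₀ 0 x).1, h2, sub_self]
  -- energy densities
  set eφ₀ : ℝ → ℝ := fun x => deriv (fun τ => φ₀ τ x) t ^ 2 + deriv (φ₀ t) x ^ 2
    + V₀ x * φ₀ t x ^ 2 with heφ₀
  set eφ : ℝ → ℝ := fun x => deriv (fun τ => φ τ x) t ^ 2 + deriv (φ t) x ^ 2
    + P x * φ t x ^ 2 with heφ
  set ew : ℝ → ℝ := fun x => deriv (fun τ => w τ x) t ^ 2 + deriv (w t) x ^ 2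
    + V₀ x * w t x ^ 2 with hew
  have heφ₀c : Continuous eφ₀ :=
    (continuous_wave1D_energyDensity hV₀ hφ₀).comp (continuous_const.prodMk continuous_id)
  have heφc : Continuous eφ :=
    (continuous_wave1D_energyDensity hP hφ).comp (continuous_const.prodMk continuous_id)
  have hewc : Continuous ew :=
    (continuous_wave1D_energyDensity hV₀ hwC).comp (continuous_const.prodMk continuous_id)
  have heφ₀n : ∀ x, 0 ≤ eφ₀ x := fun x => wave1D_energyDensity_nonneg hV₀0 t x
  have heφn : ∀ x, 0 ≤ eφ x := fun x => wave1D_energyDensity_nonneg hP0 t x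
  -- pointwise splitting on `x ≥ 1`
  have hpt : ∀ x, 1 ≤ x → eφ₀ x ≤ 2 * (1 + ε') * eφ x + 2 * ew x := by
    intro x hx
    have e1 : (fun τ => φ₀ τ x) = fun τ => φ τ x - w τ x := by funext τ; simp [hw]
    have e2 : φ₀ t = fun y => φ t y - w t y := by funext y; simp [hw]
    have hD1 : deriv (fun τ => φ₀ τ x) t = deriv (fun τ => φ τ x) t - deriv (fun τ => w τ x) t := by
      rw [e1]; exact deriv_fun_sub (hdφ t x).1 (hdw t x).1
    have hD2 : deriv (φ₀ t) x = deriv (φ t) x - deriv (w t) x := by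
      rw [e2]; exact deriv_fun_sub (hdφ t x).2 (hdw t x).2
    have e3 : φ₀ t x = φ t x - w t x := by simp [hw]
    simp only [heφ₀, heφ, hew]
    rw [hD1, hD2, e3]
    have hV := hVP x hx
    have hV0 := hV₀0 x
    have hPx := hP0 x
    nlinarith [sq_nonneg (deriv (fun τ => φ τ x) t + deriv (fun τ => w τ x) t),
      sq_nonneg (deriv (φ t) x + deriv (w t) x), sq_nonneg (φ t x + w t x),
      mul_nonneg hV0 (sq_nonneg (φ t x + w t x)), mul_nonneg hε' (sq_nonneg (deriv (φ t) x)),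
      mul_nonneg hε' (sq_nonneg (deriv (fun τ => φ τ x) t)),
      mul_nonneg (mul_nonneg hε' hPx) (sq_nonneg (φ t x)), sq_nonneg (φ t x),
      mul_nonneg hPx (sq_nonneg (φ t x - 2 * w t x))]
  -- the trapezoid bound for `w`
  have hfarφ := (wave1D_farEnergy_integrableOn hP hP0 hFφ hφ hφsol (c := 1) hFφ0 hfin t).1
  rw [abs_of_nonneg ht] at hfarφ
  have htrap : ∀ Y, 1 + t ≤ Y - t →
      (∫ x in (1 + t)..(Y - t), ew x) ≤ 4 * δ ^ 2 / (σ - 1) ^ 2 * E₀ := by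
    intro Y hY
    have hD := wave1D_trapezoid_energy_le_of_zero_data hV₀ hV₀0 hFwc hwC hwsol (a := 1) (b := Y)
      (fun x _ => hzero x) ht hY
    have hsrc : ∀ τ ∈ Icc 0 t, (∫ x in (1 + τ)..(Y - τ), Fw τ x ^ 2)
        = ∫ x in (1 + τ)..(Y - τ), ((V₀ x - P x) * φ τ x) ^ 2 := by
      intro τ hτ
      refine intervalIntegral.integral_congr fun x hx => ?_
      rw [uIcc_of_le (by linarith [hτ.2])] at hx
      have hx1 : 1 ≤ x := by linarith [hx.1, hτ.1]
      simp only [hFw, hFφ0 τ x hx1, hF₀0 τ x hx1, zero_add, sub_zero]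
    have hI : (∫ τ in (0:ℝ)..t, Real.sqrt (∫ x in (1 + τ)..(Y - τ), Fw τ x ^ 2))
        = ∫ τ in (0:ℝ)..t, Real.sqrt (∫ x in (1 + τ)..(Y - τ), ((V₀ x - P x) * φ τ x) ^ 2) := by
      refine intervalIntegral.integral_congr fun τ hτ => ?_
      rw [uIcc_of_le ht] at hτ
      simp only [hsrc τ hτ]
    have hS := far_source_sqrt_integral_le hV₀ hP hP0 hφ hFφ hφsol hFφ0 hδ hσ hq hfin ht Y hY
    have hS0 : 0 ≤ ∫ τ in (0:ℝ)..t, Real.sqrt (∫ x in (1 + τ)..(Y - τ),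
        ((V₀ x - P x) * φ τ x) ^ 2) :=
      intervalIntegral.integral_nonneg ht fun τ _ => Real.sqrt_nonneg _
    calc (∫ x in (1 + t)..(Y - t), ew x)
        ≤ 4 * (∫ τ in (0:ℝ)..t, Real.sqrt (∫ x in (1 + τ)..(Y - τ), Fw τ x ^ 2)) ^ 2 := hD
      _ ≤ 4 * (δ * Real.sqrt E₀ / (σ - 1)) ^ 2 := by
          rw [hI]; gcongr
      _ = 4 * δ ^ 2 / (σ - 1) ^ 2 * E₀ := by
          rw [div_pow, mul_pow, Real.sq_sqrt hE₀0]; ring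
  -- truncated bound for `φ₀`
  set R : ℝ := 2 * (1 + ε') * (∫ x in Ioi (1 + t), eφ x) + 8 * δ ^ 2 / (σ - 1) ^ 2 * E₀ with hR
  have htrunc : ∀ Y, 1 + t ≤ Y - t → (∫ x in (1 + t)..(Y - t), eφ₀ x) ≤ R := by
    intro Y hY
    have h1 : (∫ x in (1 + t)..(Y - t), eφ₀ x)
        ≤ ∫ x in (1 + t)..(Y - t), (2 * (1 + ε') * eφ x + 2 * ew x) :=
      intervalIntegral.integral_mono_on hY (heφ₀c.intervalIntegrable _ _)
        (((heφc.intervalIntegrable _ _).const_mul _).add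
          ((hewc.intervalIntegrable _ _).const_mul _))
        fun x hx => hpt x (by linarith [hx.1])
    have h2 : (∫ x in (1 + t)..(Y - t), (2 * (1 + ε') * eφ x + 2 * ew x))
        = 2 * (1 + ε') * (∫ x in (1 + t)..(Y - t), eφ x) + 2 * ∫ x in (1 + t)..(Y - t), ew x := by
      rw [intervalIntegral.integral_add ((heφc.intervalIntegrable _ _).const_mul _)
        ((hewc.intervalIntegrable _ _).const_mul _), intervalIntegral.integral_const_mul,
        intervalIntegral.integral_const_mul]
    have h3 : (∫ x in (1 + t)..(Y - t), eφ x) ≤ ∫ x in Ioi (1 + t), eφ x := by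
      rw [intervalIntegral.integral_of_le hY]
      exact setIntegral_mono_set hfarφ (ae_of_all _ heφn) (ae_of_all _ Ioc_subset_Ioi_self)
    have h4 := htrap Y hY
    have h5 := mul_le_mul_of_nonneg_left h3 (by positivity : (0:ℝ) ≤ 2 * (1 + ε'))
    calc (∫ x in (1 + t)..(Y - t), eφ₀ x)
        ≤ (2 * (1 + ε') * ∫ x in (1 + t)..(Y - t), eφ x) + 2 * ∫ x in (1 + t)..(Y - t), ew x :=
          h1.trans_eq h2
      _ ≤ (2 * (1 + ε') * ∫ x in Ioi (1 + t), eφ x) + 2 * (4 * δ ^ 2 / (σ - 1) ^ 2 * E₀) :=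
          add_le_add h5 (by linarith)
      _ = R := by rw [hR]; ring
  -- `Y → ∞`
  have hint : IntegrableOn eφ₀ (Ioi (1 + t)) := by
    refine integrableOn_Ioi_of_intervalIntegral_norm_bounded (μ := volume) (l := atTop)
      (b := fun Y : ℝ => Y - t) R (1 + t) (fun Y => (heφ₀c.integrableOn_Icc).mono_set
        Ioc_subset_Icc_self) (tendsto_atTop_add_const_right _ _ tendsto_id) ?_
    filter_upwards [eventually_ge_atTop (1 + 2 * t)] with Y hY
    have hY' : 1 + t ≤ Y - t := by linarith
    calc (∫ x in (1 + t)..(Y - t), ‖eφ₀ x‖) = ∫ x in (1 + t)..(Y - t), eφ₀ x := by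
          refine intervalIntegral.integral_congr fun x _ => ?_
          simp only [Real.norm_eq_abs, abs_of_nonneg (heφ₀n x)]
      _ ≤ R := htrunc Y hY'
  refine ⟨hint, ?_⟩
  have hlim : Tendsto (fun Y : ℝ => ∫ x in (1 + t)..(Y - t), eφ₀ x) atTop
      (𝓝 (∫ x in Ioi (1 + t), eφ₀ x)) :=
    intervalIntegral_tendsto_integral_Ioi (1 + t) hint
      (tendsto_atTop_add_const_right _ _ tendsto_id)
  refine le_of_tendsto hlim ?_
  filter_upwards [eventually_ge_atTop (1 + 2 * t)] with Y hY
  exact htrunc Y (by linarith)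

end

end Literature.Analysis.PDE
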